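import Mathlib
import HarnessLib
import Summits.HubbardSuperconductivity.HubbardSuperconductivity.Theorems.KLProgrammePerturbedFermiCurveFrameHessBridge

/-!
# Route `KLProgramme` — ENGINE child (stmt-HubbardSuperconductivity-20437 `KLRegimeEngineV17F2`): the SEPARATION HYPOTHESES of the two transfer regimes on
# the frame's Fermi curve (step (T3) packaging; design note HOME/hubbard-kl-k3c2-p2/TWO-SHELL-FRAME-PORT.md §9)

Cell `gate-hubbard-kl`, seat hubbard-kl-k3c2-p2 g15.  The Cooper-regime lemma `volume_sublevel_le_cooper_of_geomConstants` and the caustic-regime lemma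
`volume_sublevel_le_caustic_of_geomConstants` take their separation hypotheses in the raw form
`∀ m ∈ ℤ², ∃ i, R₀ < |v_i + 2πm_i|` (transfer not `R₀`-close to `2πℤ²`) and `∀ θ m, ∃ i, R₀ < |2p(θ)_i − v_i − 2πm_i|` (no caustic translate in reach).
This module discharges them from sizes (for the (T3) packaging of the constants):
* `abs_curve_le_umklappRadius_frame` — the frame curve lies in the umklapp square `|p(θ)_i| ≤ K(b) < π` (`abs_le_umklappRadius_of_sqDispersion_eq` at the
  shifted level `ν − δ_K(p) ≤ b`);
* `lattice_far_of_transfer` — `R₀ < |v|_∞` and `|v_i| + R₀ < 2π` give the first hypothesis;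
* `caustic_far_of_small_transfer` — `|v|_∞ ≤ V` with `R₀ + V < √2·u_min` and `R₀ + V + 2K(b) < 2π` give the second (Cooper regime: no caustic in reach);
* `exists_eq_smul_dir` — polar form `v = r·dir ψ` of a transfer with `|v|_∞ ≤ r ≤ √2|v|_∞` (the Cooper lemma is stated for `v = r·dir ψ`).
Everything is PROVED; no definitions, no named facts; nothing asserts any stub or superconductivity.
References: DECOMP App. E Lemma E.1/E.3; BGM 2006 Remark after (2.39) [cite: BenfattoGiulianiMastropietro2006]; FST II App. B [cite: FeldmanSalmhoferTrubowitz1998].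
-/

noncomputable section

namespace Summit.HubbardSuperconductivity.HubbardSuperconductivity.Theorems.PerturbedFermiCurve

set_option linter.dupNamespace false -- summit = problem name (single-conjunct summit), D-0017

open Real Set
open Literature.MathematicalPhysics.QuantumLattice Literature.MathematicalPhysics.QuantumLattice.BandSectorCounting
open Literature.MathematicalPhysics.QuantumLattice.FermiRG
open Summit.HubbardSuperconductivity.HubbardSuperconductivity.Theorems.DispersionFlow
open Summit.HubbardSuperconductivity.HubbardSuperconductivity.Theorems.KLRegimeSplit

/-! ## §1 Polar form of a transfer -/

/-- **Polar form**: every `v ∈ ℝ²` is `r·dir ψ` with `r = √(v₀² + v₁²) ≥ 0`, and `|v_i| ≤ r ≤ √2·max|v_i|`. [folklore] -/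
theorem exists_eq_smul_dir (v : Fin 2 → ℝ) :
    ∃ r ψ : ℝ, 0 ≤ r ∧ v = r • dir ψ ∧ (∀ i, |v i| ≤ r) ∧ r ≤ Real.sqrt 2 * max |v 0| |v 1| := by
  set r := Real.sqrt (v 0 ^ 2 + v 1 ^ 2) with hr
  have hr0 : 0 ≤ r := Real.sqrt_nonneg _
  have hr2 : r ^ 2 = v 0 ^ 2 + v 1 ^ 2 := Real.sq_sqrt (by positivity)
  have hvi : ∀ i, |v i| ≤ r := by
    intro i
    have h : v i ^ 2 ≤ r ^ 2 := by
      rw [hr2]; fin_cases i <;> simp <;> nlinarith [sq_nonneg (v 0), sq_nonneg (v 1)]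
    rw [← sq_abs] at h
    exact (pow_le_pow_iff_left₀ (abs_nonneg _) hr0 two_ne_zero).1 h
  have hrle : r ≤ Real.sqrt 2 * max |v 0| |v 1| := by
    set M := max |v 0| |v 1| with hM
    have hM0 : 0 ≤ M := (abs_nonneg _).trans (le_max_left _ _)
    have h0 : v 0 ^ 2 ≤ M ^ 2 := by rw [← sq_abs]; exact pow_le_pow_left₀ (abs_nonneg _) (le_max_left _ _) 2
    have h1 : v 1 ^ 2 ≤ M ^ 2 := by rw [← sq_abs]; exact pow_le_pow_left₀ (abs_nonneg _) (le_max_right _ _) 2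
    have h3 : r ^ 2 ≤ (Real.sqrt 2 * M) ^ 2 := by
      rw [hr2, mul_pow, Real.sq_sqrt (by norm_num : (0:ℝ) ≤ 2)]; linarith
    exact (pow_le_pow_iff_left₀ hr0 (by positivity) two_ne_zero).1 h3
  by_cases hz : r = 0
  · refine ⟨0, 0, le_rfl, ?_, fun i => ?_, ?_⟩
    · have h0 : ∀ i, v i = 0 := fun i => by
        have := hvi i; rw [hz] at this; exact abs_eq_zero.1 (le_antisymm this (abs_nonneg _))
      funext i; simp [h0 i]
    · rw [← hz]; exact hvi i
    · positivity
  · have hrpos : 0 < r := lt_of_le_of_ne hr0 (Ne.symm hz)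
    set z : ℂ := ⟨v 0, v 1⟩ with hzdef
    have hzabs : ‖z‖ = r := by
      rw [Complex.norm_def, Complex.normSq_mk, hr]
      congr 1; ring
    have hz0 : z ≠ 0 := by
      intro h; rw [h, norm_zero] at hzabs; exact hz hzabs.symm
    refine ⟨r, Complex.arg z, hr0, ?_, hvi, hrle⟩
    have hc : Real.cos (Complex.arg z) = v 0 / r := by rw [Complex.cos_arg hz0, hzabs]
    have hs : Real.sin (Complex.arg z) = v 1 / r := by rw [Complex.sin_arg, hzabs]
    funext i; fin_cases i
    · simp [dir, hc]; field_simp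
    · simp [dir, hs]; field_simp

/-! ## §2 The transfer is not close to the lattice -/

/-- **`v` is not `R₀`-close to `2πℤ²`** once `R₀ < |v|_∞` and `|v_i| + R₀ < 2π`. [folklore] -/
theorem lattice_far_of_transfer {v : Fin 2 → ℝ} {R₀ : ℝ} (hR : R₀ < max |v 0| |v 1|) (hsmall : ∀ i, |v i| + R₀ < 2 * π) :
    ∀ m : Fin 2 → ℤ, ∃ i, R₀ < |v i + m i * (2 * π)| := by
  intro m
  by_cases hm : ∀ i, m i = 0
  · rcases le_total |v 0| |v 1| with h | h
    · refine ⟨1, ?_⟩; rw [hm 1]; simp only [Int.cast_zero, zero_mul, add_zero]; rwa [max_eq_right h] at hR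
    · refine ⟨0, ?_⟩; rw [hm 0]; simp only [Int.cast_zero, zero_mul, add_zero]; rwa [max_eq_left h] at hR
  · push Not at hm
    obtain ⟨i, hi⟩ := hm
    refine ⟨i, ?_⟩
    have h1 : (1 : ℝ) ≤ |(m i : ℝ)| := by
      rw [← Int.cast_abs]; exact_mod_cast Int.one_le_abs hi
    have h2 : 2 * π ≤ |(m i : ℝ) * (2 * π)| := by
      rw [abs_mul, abs_of_pos (by positivity : (0:ℝ) < 2 * π)]; nlinarith [Real.pi_pos]
    have h3 : |(m i : ℝ) * (2 * π)| - |v i| ≤ |v i + m i * (2 * π)| := by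
      have := abs_sub_abs_le_abs_sub ((m i : ℝ) * (2 * π)) (-v i)
      rw [abs_neg, show (m i : ℝ) * (2 * π) - -v i = v i + m i * (2 * π) by ring] at this
      exact this
    linarith [hsmall i]

/-! ## §3 No caustic translate in reach of a small transfer -/

section Root

variable {a b : ℝ} (B : BandBounds a b) {K : TrigPolyC4v} {κ₀ ν : ℝ}
  (hδ : ∀ k : Fin 2 → ℝ, (∀ i, |k i| ≤ π) → |(fun k : Fin 2 → ℝ => -K.eval k) k| ≤ κ₀) (hlo : a ≤ ν - κ₀) (hhi : ν + κ₀ ≤ b)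
  {u : ℝ → ℝ} (hu : ∀ θ, IsBandFermiRadius (ν - (fun k : Fin 2 → ℝ => -K.eval k) (u θ • dir θ)) θ (u θ))
include B hδ hlo hhi hu

omit B in
/-- **The frame curve lies in the umklapp square**: `|p(θ)_i| ≤ K(b)` (`K` the umklapp radius at the top admissible level). [cite: BenfattoGiulianiMastropietro2006, Remark after (2.39)] -/
theorem abs_curve_le_umklappRadius_frame (θ : ℝ) (i : Fin 2) : |(u θ • dir θ) i| ≤ umklappRadius b := by
  have hsq : ∀ j, |(u θ • dir θ) j| ≤ π := abs_apply_le_pi_of_isBandFermiRadius (hu θ)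
  have hm := shiftedLevel_mem_Icc (hu θ) hδ hlo hhi
  have he : sqDispersion (u θ • dir θ) = ν - (fun k : Fin 2 → ℝ => -K.eval k) (u θ • dir θ) := by
    have h := ((isBandFermiRadius_shifted_iff (fun k : Fin 2 → ℝ => -K.eval k) ν θ (u θ)).1 (hu θ)).2
    linarith [h]
  exact (abs_le_umklappRadius_of_sqDispersion_eq hsq he i).trans (umklappRadius_mono hm.2)

/-- **No caustic translate in reach of a small transfer** (Cooper regime): if `|v|_∞ ≤ V`, `R₀ + V < √2·u_min` and `R₀ + V + 2K(b) < 2π`, then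
`∀ θ m, ∃ i, R₀ < |2p(θ)_i − v_i − 2πm_i|`. [folklore] -/
theorem caustic_far_of_small_transfer {v : Fin 2 → ℝ} {R₀ V : ℝ} (hV : ∀ i, |v i| ≤ V) (h1 : R₀ + V < Real.sqrt 2 * B.umin)
    (h2 : R₀ + V + 2 * umklappRadius b < 2 * π) (θ : ℝ) :
    ∀ m : Fin 2 → ℤ, ∃ i, R₀ < |2 * (u θ • dir θ) i - v i - m i * (2 * π)| := by
  intro m
  have hum : B.umin ≤ u θ := umin_le_of_shifted B hδ hlo hhi (hu θ)
  have hup := B.umin_pos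
  have hK := fun i => abs_curve_le_umklappRadius_frame hδ hlo hhi hu θ i
  by_cases hm : ∀ i, m i = 0
  · -- `m = 0`: the larger coordinate of `2p(θ)` is `≥ √2 u`
    have hx : (u θ • dir θ) 0 = u θ * Real.cos θ := by simp [dir]
    have hy : (u θ • dir θ) 1 = u θ * Real.sin θ := by simp [dir]
    have hsum : ((u θ • dir θ) 0) ^ 2 + ((u θ • dir θ) 1) ^ 2 = u θ ^ 2 := by
      rw [hx, hy]; nlinarith [Real.sin_sq_add_cos_sq θ]
    -- one of the coordinates has square `≥ u²/2`
    rcases le_total (((u θ • dir θ) 1) ^ 2) (((u θ • dir θ) 0) ^ 2) with hle | hle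
    · refine ⟨0, ?_⟩
      have hsq : (Real.sqrt 2 * B.umin / 2) ^ 2 ≤ ((u θ • dir θ) 0) ^ 2 := by
        have e : (Real.sqrt 2 * B.umin / 2) ^ 2 = B.umin ^ 2 / 2 := by
          rw [div_pow, mul_pow, Real.sq_sqrt (by norm_num : (0:ℝ) ≤ 2)]; ring
        rw [e]; nlinarith [pow_le_pow_left₀ hup.le hum 2]
      have habs : Real.sqrt 2 * B.umin / 2 ≤ |(u θ • dir θ) 0| := by
        rw [← sq_abs ((u θ • dir θ) 0)] at hsq
        exact (pow_le_pow_iff_left₀ (by positivity) (abs_nonneg _) two_ne_zero).1 hsq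
      rw [hm 0]; simp only [Int.cast_zero, zero_mul, sub_zero]
      have h3 : 2 * |(u θ • dir θ) 0| - |v 0| ≤ |2 * (u θ • dir θ) 0 - v 0| := by
        have := abs_sub_abs_le_abs_sub (2 * (u θ • dir θ) 0) (v 0)
        rw [abs_mul, abs_two] at this; exact this
      linarith [hV 0]
    · refine ⟨1, ?_⟩
      have hsq : (Real.sqrt 2 * B.umin / 2) ^ 2 ≤ ((u θ • dir θ) 1) ^ 2 := by
        have e : (Real.sqrt 2 * B.umin / 2) ^ 2 = B.umin ^ 2 / 2 := by
          rw [div_pow, mul_pow, Real.sq_sqrt (by norm_num : (0:ℝ) ≤ 2)]; ring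
        rw [e]; nlinarith [pow_le_pow_left₀ hup.le hum 2]
      have habs : Real.sqrt 2 * B.umin / 2 ≤ |(u θ • dir θ) 1| := by
        rw [← sq_abs ((u θ • dir θ) 1)] at hsq
        exact (pow_le_pow_iff_left₀ (by positivity) (abs_nonneg _) two_ne_zero).1 hsq
      rw [hm 1]; simp only [Int.cast_zero, zero_mul, sub_zero]
      have h3 : 2 * |(u θ • dir θ) 1| - |v 1| ≤ |2 * (u θ • dir θ) 1 - v 1| := by
        have := abs_sub_abs_le_abs_sub (2 * (u θ • dir θ) 1) (v 1)
        rw [abs_mul, abs_two] at this; exact this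
      linarith [hV 1]
  · push Not at hm
    obtain ⟨i, hi⟩ := hm
    refine ⟨i, ?_⟩
    have hmi : (1 : ℝ) ≤ |(m i : ℝ)| := by
      rw [← Int.cast_abs]; exact_mod_cast Int.one_le_abs hi
    have h2π : 2 * π ≤ |(m i : ℝ) * (2 * π)| := by
      rw [abs_mul, abs_of_pos (by positivity : (0:ℝ) < 2 * π)]; nlinarith [Real.pi_pos]
    have h3 : |(m i : ℝ) * (2 * π)| - |2 * (u θ • dir θ) i - v i| ≤ |2 * (u θ • dir θ) i - v i - m i * (2 * π)| := by
      have := abs_sub_abs_le_abs_sub ((m i : ℝ) * (2 * π)) (2 * (u θ • dir θ) i - v i)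
      rw [abs_sub_comm ((m i : ℝ) * (2 * π))] at this
      exact this
    have h4 : |2 * (u θ • dir θ) i - v i| ≤ 2 * umklappRadius b + V := by
      have := abs_sub (2 * (u θ • dir θ) i) (v i)
      rw [abs_mul, abs_two] at this
      linarith [hK i, hV i]
    linarith

end Root

end Summit.HubbardSuperconductivity.HubbardSuperconductivity.Theorems.PerturbedFermiCurve

end
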